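import Mathlib
import HarnessLib
import Literature.NumberTheory.LFunctions.ZetaScrew
import Summits.RiemannHypothesis.RiemannHypothesis.Theorems.IntegerScrewIncrementSharp
import Summits.RiemannHypothesis.RiemannHypothesis.Theorems.IntegerScrewHingeCovariance

/-!
# Route `IntegerScrew` — the hinge brackets for ALL `M`: `M·Cov(I_M, I_{⌈M/n⌉}) → −Λ(n)/√n` and
# `M·Var(I_{⌈M/n⌉})/log M → n` (PIVOT-LAW §15.12/§15.14, kernel road (3)–(4); RH-FREE)

`IntegerScrewHingeCovariance.tendsto_hingeCov` gives the hinge resonance along each residue class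
`M = n r + j` (`1 ≤ j ≤ n`, carrier `⌈M/n⌉ = r + 1`).  For the JOINT arithmetic floor (several prime
powers at once) the limits are needed along ALL `M`, with the carrier written as the function
`⌈M/n⌉ = (M + n − 1)/n` of `M`:

* `tendsto_atTop_of_residues` — a sequence converges if it converges along every residue class mod `n`;
* `ceilDiv_residue` — `(n r + j + n − 1)/n = r + 1` for `1 ≤ j ≤ n`;
* **`tendsto_hingeCov_ceil`** — for `n ≥ 2`:
  `M·[Ψ(log(M/(c−1))) + Ψ(log((M−1)/c)) − Ψ(log(M/c)) − Ψ(log((M−1)/(c−1)))] → −Λ(n)/√n`, `c = ⌈M/n⌉`,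
  as `M → ∞` through all integers;
* `tendsto_hingeEnergy_div_log_residue`, **`tendsto_hingeEnergy_div_log`** — the carrier's scaled
  variance `M·2Ψ(log(c/(c−1)))/log M → n` (`c·2Ψ(h_c) = log c − c₀ + o(1)` at the corner `c`,
  `log c/log M → 1`, `M/c → n`).

Statements about the explicit function `Ψ`; nothing here bears on the truth of RH. [Suzuki2023, (1.1)]
-/

noncomputable section

-- D-0017: `Summit.<S>.<S>.…` is the designed namespace of a single-problem summit.
set_option linter.dupNamespace false

namespace Summit.RiemannHypothesis.RiemannHypothesis.Theorems.IntegerScrew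

open Literature.NumberTheory.LFunctions Filter Finset
open scoped Topology

/-! ### From residue classes to all integers -/

/-- A sequence tends to a filter `l` along `atTop` as soon as it does along every residue class
`M = n r + j`, `1 ≤ j ≤ n` (`n ≥ 1`). [folklore] -/
theorem tendsto_atTop_of_residues {α : Type*} {l : Filter α} {f : ℕ → α} {n : ℕ} (hn : 1 ≤ n)
    (h : ∀ j, 1 ≤ j → j ≤ n → Tendsto (fun r : ℕ => f (n * r + j)) atTop l) :
    Tendsto f atTop l := by
  rw [tendsto_atTop']
  intro U hU
  have hall : ∀ j ∈ Finset.Icc 1 n, ∀ᶠ r : ℕ in atTop, f (n * r + j) ∈ U := fun j hj =>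
    (h j (Finset.mem_Icc.1 hj).1 (Finset.mem_Icc.1 hj).2).eventually hU
  rw [← eventually_all_finset] at hall
  obtain ⟨R, hR⟩ := eventually_atTop.1 hall
  refine ⟨n * R + 1, fun M hM => ?_⟩
  -- write M = n r + j with j = (M − 1) % n + 1 ∈ [1, n], r = (M − 1) / n ≥ R
  set r := (M - 1) / n with hr
  set j := (M - 1) % n + 1 with hj
  have hM1 : M - 1 = n * r + (M - 1) % n := (Nat.div_add_mod (M - 1) n).symm
  have hMeq : M = n * r + j := by omega
  have hjn : j ≤ n := by
    have := Nat.mod_lt (M - 1) (by omega : 0 < n)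
    omega
  have hrR : R ≤ r := by
    rw [hr, Nat.le_div_iff_mul_le (by omega)]
    have : n * R ≤ M - 1 := by omega
    linarith [Nat.mul_comm R n]
  rw [hMeq]
  exact hR r hrR j (Finset.mem_Icc.2 ⟨by omega, hjn⟩)

/-- `⌈M/n⌉` on a residue class: `(n r + j + n − 1)/n = r + 1` for `1 ≤ j ≤ n`. [folklore] -/
theorem ceilDiv_residue {n r j : ℕ} (hj1 : 1 ≤ j) (hjn : j ≤ n) :
    (n * r + j + n - 1) / n = r + 1 := by
  have hn : 0 < n := by omega
  have e : n * r + j + n - 1 = (j - 1) + n * (r + 1) := by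
    zify [hj1, (by omega : 1 ≤ n * r + j + n)]
    ring
  rw [e, Nat.add_mul_div_left _ _ hn, Nat.div_eq_of_lt (by omega : j - 1 < n), zero_add]

/-- `r ↦ n·r + j` tends to infinity for `n ≥ 1`. [folklore] -/
private theorem tendsto_const_mul_add_nat'' {n : ℕ} (hn : 1 ≤ n) (j : ℕ) :
    Tendsto (fun r : ℕ => n * r + j) atTop atTop :=
  Filter.tendsto_atTop_mono (fun r => (Nat.le_mul_of_pos_left r (by omega)).trans
    (Nat.le_add_right _ _)) tendsto_id

/-! ### The hinge row bracket along all `M` -/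

/-- **THE HINGE RESONANCE ALONG ALL INTEGERS.**  For `n ≥ 2`, with `c = ⌈M/n⌉ = (M + n − 1)/n`:
`M·[Ψ(log(M/(c−1))) + Ψ(log((M−1)/c)) − Ψ(log(M/c)) − Ψ(log((M−1)/(c−1)))] → −Λ(n)/√n` as `M → ∞`,
i.e. `M·Cov(I_M, I_{⌈M/n⌉}) → −Λ(n)/√n` through every `M` (PIVOT-LAW §15.12: the hinge mass is never
split). [folklore] -/
theorem tendsto_hingeCov_ceil {n : ℕ} (hn : 2 ≤ n) :
    Tendsto (fun M : ℕ => (M : ℝ) *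
        (zetaScrew (Real.log ((M : ℝ) / ((((M + n - 1) / n : ℕ) : ℝ) - 1)))
          + zetaScrew (Real.log (((M : ℝ) - 1) / (((M + n - 1) / n : ℕ) : ℝ)))
          - zetaScrew (Real.log ((M : ℝ) / (((M + n - 1) / n : ℕ) : ℝ)))
          - zetaScrew (Real.log (((M : ℝ) - 1) / ((((M + n - 1) / n : ℕ) : ℝ) - 1)))))
      atTop (𝓝 (-(ArithmeticFunction.vonMangoldt n / Real.sqrt n))) := by
  refine tendsto_atTop_of_residues (n := n) (by omega) fun j hj1 hjn => ?_
  refine (tendsto_hingeCov hn hj1 hjn).congr fun r => ?_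
  have hc : (n * r + j + n - 1) / n = r + 1 := ceilDiv_residue hj1 hjn
  simp only [hc]
  push_cast
  ring_nf

/-! ### The carrier's variance -/

/-- Along the residue class `M = n r + j` (`n ≥ 1`): `M·2Ψ(log((r+1)/r))/log M → n` — the scaled
variance of the carrier increment `I_{r+1}` (`(r+1)·2Ψ(h_{r+1}) − log(r+1) → −c₀` by
`tendsto_incrementEnergy_sub_log`, `log(r+1)/log M → 1`, `M/(r+1) → n`). [folklore] -/
theorem tendsto_hingeEnergy_div_log_residue {n : ℕ} (hn : 1 ≤ n) (j : ℕ) :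
    Tendsto (fun r : ℕ => ((n * r + j : ℕ) : ℝ) *
      (2 * zetaScrew (Real.log (((r + 1 : ℕ) : ℝ) / (((r + 1 : ℕ) : ℝ) - 1))))
        / Real.log ((n * r + j : ℕ) : ℝ)) atTop (𝓝 (n : ℝ)) := by
  have hn0 : (0 : ℝ) < n := by exact_mod_cast (by omega : 0 < n)
  have hcastM : ∀ r : ℕ, ((n * r + j : ℕ) : ℝ) = (n : ℝ) * r + j := fun r => by push_cast; ring
  have hlogM : Tendsto (fun r : ℕ => Real.log ((n * r + j : ℕ) : ℝ)) atTop atTop :=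
    (Real.tendsto_log_atTop.comp tendsto_natCast_atTop_atTop).comp
      (tendsto_const_mul_add_nat'' hn j)
  -- E(r) := (r+1)·2Ψ(h_{r+1}) − log(r+1) → −c₀, hence E/log M → 0
  have hE := tendsto_incrementEnergy_sub_log.comp (tendsto_add_atTop_nat 1)
  have hE' : Tendsto (fun r : ℕ => ((((r + 1 : ℕ) : ℝ) *
      (2 * zetaScrew (Real.log (((r + 1 : ℕ) : ℝ) / (((r + 1 : ℕ) : ℝ) - 1))))
      - Real.log ((r + 1 : ℕ) : ℝ)) / Real.log ((n * r + j : ℕ) : ℝ))) atTop (𝓝 0) :=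
    hE.div_atTop hlogM
  -- M/(r+1) → n
  have hq : Tendsto (fun r : ℕ => ((n * r + j : ℕ) : ℝ) / ((r + 1 : ℕ) : ℝ)) atTop (𝓝 (n : ℝ)) := by
    have h1 : Tendsto (fun r : ℕ => ((n : ℝ) + ((j : ℝ) - n) / ((r : ℝ) + 1))) atTop
        (𝓝 ((n : ℝ) + 0)) := by
      refine tendsto_const_nhds.add (tendsto_const_nhds.div_atTop ?_)
      have := tendsto_atTop_add_const_right atTop (1 : ℝ) tendsto_natCast_atTop_atTop
      simpa using this
    rw [add_zero] at h1
    refine h1.congr fun r => ?_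
    rw [hcastM]; push_cast
    field_simp
    ring
  -- log(r+1)/log M → 1
  have hratio : Tendsto (fun r : ℕ => Real.log ((r + 1 : ℕ) : ℝ) / Real.log ((n * r + j : ℕ) : ℝ))
      atTop (𝓝 1) := by
    have hlogq : Tendsto (fun r : ℕ => Real.log (((n * r + j : ℕ) : ℝ) / ((r + 1 : ℕ) : ℝ)))
        atTop (𝓝 (Real.log n)) := (Real.continuousAt_log hn0.ne').tendsto.comp hq
    have h0 : Tendsto (fun r : ℕ => Real.log (((n * r + j : ℕ) : ℝ) / ((r + 1 : ℕ) : ℝ))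
        / Real.log ((n * r + j : ℕ) : ℝ)) atTop (𝓝 0) := hlogq.div_atTop hlogM
    have h1 : Tendsto (fun r : ℕ => 1 - Real.log (((n * r + j : ℕ) : ℝ) / ((r + 1 : ℕ) : ℝ))
        / Real.log ((n * r + j : ℕ) : ℝ)) atTop (𝓝 (1 - 0)) := tendsto_const_nhds.sub h0
    rw [sub_zero] at h1
    refine h1.congr' ?_
    filter_upwards [eventually_ge_atTop 2] with r hr
    have hr1 : (0 : ℝ) < ((r + 1 : ℕ) : ℝ) := by positivity
    have hM1 : (1 : ℝ) < ((n * r + j : ℕ) : ℝ) := by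
      rw [hcastM]
      have : (2 : ℝ) ≤ r := by exact_mod_cast hr
      have : (1 : ℝ) ≤ n := by exact_mod_cast hn
      nlinarith
    have hM0 : (0 : ℝ) < ((n * r + j : ℕ) : ℝ) := by linarith
    have hlog0 : Real.log ((n * r + j : ℕ) : ℝ) ≠ 0 := (Real.log_pos hM1).ne'
    rw [Real.log_div hM0.ne' hr1.ne']
    field_simp
    ring
  have htot := hq.mul (hE'.add hratio)
  rw [zero_add, mul_one] at htot
  refine htot.congr' ?_
  filter_upwards [eventually_ge_atTop 2] with r hr
  have hr1 : (0 : ℝ) < ((r + 1 : ℕ) : ℝ) := by positivity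
  have hM1 : (1 : ℝ) < ((n * r + j : ℕ) : ℝ) := by
    rw [hcastM]
    have : (2 : ℝ) ≤ r := by exact_mod_cast hr
    have : (1 : ℝ) ≤ n := by exact_mod_cast hn
    nlinarith
  have hlog0 : Real.log ((n * r + j : ℕ) : ℝ) ≠ 0 := (Real.log_pos hM1).ne'
  field_simp
  ring

/-- **THE CARRIER'S VARIANCE ALONG ALL INTEGERS.**  For `n ≥ 2`, with `c = ⌈M/n⌉ = (M + n − 1)/n`:
`M·2Ψ(log(c/(c−1)))/log M → n` as `M → ∞` — the scaled variance of `I_{⌈M/n⌉}` is `n·log M·(1+o(1))`.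
[folklore] -/
theorem tendsto_hingeEnergy_div_log {n : ℕ} (hn : 2 ≤ n) :
    Tendsto (fun M : ℕ => (M : ℝ) *
      (2 * zetaScrew (Real.log ((((M + n - 1) / n : ℕ) : ℝ) / ((((M + n - 1) / n : ℕ) : ℝ) - 1))))
        / Real.log (M : ℝ)) atTop (𝓝 (n : ℝ)) := by
  refine tendsto_atTop_of_residues (n := n) (by omega) fun j hj1 hjn => ?_
  refine (tendsto_hingeEnergy_div_log_residue (n := n) (by omega) j).congr fun r => ?_
  have hc : (n * r + j + n - 1) / n = r + 1 := ceilDiv_residue hj1 hjn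
  simp only [hc]

end Summit.RiemannHypothesis.RiemannHypothesis.Theorems.IntegerScrew

end
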